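import Summits.QuantumFields.YangMills.Theorems.BalabanUVNodesN21GappedTopPair13CoPHDefs
import Summits.QuantumFields.YangMills.Theorems.BalabanUVNodesN21TwoRunDeviceOfBgCloseness

/-!
# N21 (NE7c) · THE CONSUMER's JUNCTION FOR THE (3.3) FAMILY OF THE GAPPED TOP PAIR (dag-n21-w7's `bFactorAt ∕ bGapAt ∕ bCutGrid`): the device at the (3.3) factor from two-run
# closeness of the FLUCTUATION variables, «design (i)'s (3.3) deficit ≤ the gapped (3.3) deficit», identical indicator sets on the gapped support, and the (3.3) grid rows for the dials

Track A of `YM-PLAN.md` (cell `pub-ymgap`), node **N21** (NE7c, NOT PRINTED); WIDTH SEAT `pub-ymgap-dag-n21-w2` (gen 3), file 7.  THEOREMS ONLY: 0 `def`, 0 `sorry`; COUNT-NEUTRAL;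
`--kind proof --supports stmt-QuantumFields-27366 --as helper` (K3⁸ `SpineGivenEndpointR13SepCoPHV`).  Imports dag-n21-w7's definition lane `…N21GappedTopPair13CoPHDefs` (p624908 ✓:
`bFactorAt`, `bFactorAt_mul_self ∕ _nonneg ∕ _le_one ∕ _mono`, `bWeightAt_eq_prod`, `bGapAt`, `bGapAt_self`, `bGapAt_of_subset`, `bCutGrid`, `bCutGrid_succ`; → def-T FILE 19 `bWeightAt`,
r11 `B14.Sect3Decomp.SmallApproxFluct ∕ Vbox ∕ Sect3Data.bondsStar`) and this seat's file 3 `…N21TwoRunDeviceOfBgCloseness` (p625475 ✓: `eq_one_of_prod_ge_one`; → file 1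
`prod_gapFamily_le_core_of_device`, `coreFamily_le_term`; file 2 `exists_dials_of_summable`).  No Theses import; restates nothing.

WHY.  This seat's files 1 ∕ 3 ∕ 5 type the consumer's junction for the (3.2) family `a|_θ(P)` of the last 𝐓-step (dag-n21-d's gapped top cut).  dag-n21-w7 g2 has gapped the (3.3)
family `b|_{δ′}(P, Q)` the same way (`bGapAt δlo δhi`: small-fluctuation factors at the LOWER letter off `Q`, large ones at the UPPER letter on `Q`; grid `bCutGrid = 2δ_k(1−ρ′)^j`).
Design (i) refines run A's (3.3) factors against run B's too; the mismatch is again dominated by the gapped deficit as soon as the two runs' TESTED FLUCTUATION VARIABLES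
`|V_k(b)(V^{(k)}_{□′}(b))⁻¹ − 1|` are `Δ′`-close bond by bond through the site identification and the (3.3) collar clears `Δ′`.  THIS FILE is that twin: §1 the device at `bFactorAt`
from bond-wise domination of the fluctuation variables (r11's `SmallApproxFluct` read on the two runs' pinned (3.3) data); §2 the junction at `bWeightAt ∕ bGapAt` through file 1's
letter-indexed product lemmas; §3 identical (3.3) indicator sets on the gapped support; §4 the (3.3) grid rows at `bCutGrid` (collar clears `2δ_k·δ′′`, factor-two window) so that file 2's
`exists_dials_of_summable` — read with the (3.3) relative closeness letter — delivers dag-n21-w7's second dial pair `(ρ′, n₂)`.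

WHAT IS PROVED ([folklore] ∕ [bookkeeping] BY NAME).
* §1 `smallApproxFluct_of_dominated` · ★★ `bFactorAt_le_bFactorAt_add_of_fluctDominated` · `bDevice_AB_of_fluctClose` ∕ `bDevice_BA_of_fluctClose` (family forms along `ι`).
* §2 ★★ `bGapAt_le_core_of_device` ∕ `core_le_bWeightAt` ∕ ★★★ `bWeightAt_sub_core_le_bWeightAt_sub_bGapAt_of_device` (ANY run-B
  factor family in `[0,1]`, monotone, with the two devices) · ★★★ `bWeightAt_sub_core_le_bWeightAt_sub_bGapAt_of_fluctClose` (run B's `bFactorAt` through `ι`, from §1).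
* §3 ★★ `bFactors_agree_on_gapped_support` (on `bGapAt δlo δhi s P Q U V ≠ 0`: run B's (3.3) factors at `δ′` through `ι` EQUAL run A's — `= 1` off `Q`, `= 0` on `Q`).
* §4 (3.3) grid: `bCutGrid_succ_add_le` · `bCutGrid_collar_clears` · `half_letter_le_bCutGrid` · `bCutGrid_le_letter` · ★ `bCollar_rows_of_dials` (the four rows at any depth `j ≤ n₂`
  from the dials' rows for the (3.3) closeness letter, given `0 ≤ δ_k`).
* §5 A2∕A6 sanity: `fluctDominated_refl` (the domination hypothesis is inhabited by a run against itself, `Δ′ = 0`) · ★ `bGapAt_le_bWeightAt_of_self` (the (3.3) junction at `ι = id`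
  RECOVERS dag-n21-w7's `bGapAt_le_bWeightAt` through `bFactorAt_mul_self`).

HONEST FRAMING.  The bond-wise domination ∕ closeness hypotheses are DISPLAYED (the two-run closeness of the fluctuation variables at the (3.3) scale — NE3 species, NOT PRINTED; inhabited
here only in the degenerate self-instance of §5); `ι`, the collars and the dial rows are the consumer's; nothing about the pinned data `sect3DataOfRecord` ∕ `Vbox` is proved; nothing of Bałaban's asserted; NE7c NOT
PRINTED ∕ NOT proved at print's thresholds; **N21 NOT discharged**; K3⁷∕K3⁸ NOT claimed; counts UNMOVED (typed 28∕28 · discharged 5∕27); never a count claim.  One finite four-torus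
programme at fixed `ε` — NOT ℝ⁴, NOT OS, NOT a mass gap, NOT the Clay problem.  No decl below carries a cite tag.
-/

open Finset

namespace Summit.QuantumFields.YangMills.Theorems.N21GappedCollarDesignIPair

open Literature.MathematicalPhysics.QuantumFieldTheory.Balaban1983to89
open Literature.MathematicalPhysics.QuantumFieldTheory.Balaban1983to89.T4Continuum
open Literature.MathematicalPhysics.QuantumFieldTheory.Balaban1983to89.Node00
open B14.Sect3Decomp (SmallApproxFluct Vbox)
open GaugeGroup (dist1)
open Summit.QuantumFields.YangMills.Theorems.N21GappedTopPair13CoPH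
  (bFactorAt bFactorAt_mul_self bFactorAt_nonneg bFactorAt_le_one bFactorAt_mono bWeightAt_eq_prod bGapAt bGapAt_self bGapAt_of_subset bCutGrid bCutGrid_succ)
open Summit.QuantumFields.YangMills.Theorems.N21GappedCollarDesignI (prod_gapFamily_le_core_of_device coreFamily_le_term)
open Summit.QuantumFields.YangMills.Theorems.N21TwoRunDevice (eq_one_of_prod_ge_one)
open Summit.QuantumFields.YangMills.Theorems.N21ShellSplitOfRecord13CoPH (eq_zero_or_one_of_mul_self)

/-! ## §1 The device at dag-n21-w7's (3.3) factor from bond-wise domination of the fluctuation variables -/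

section Device

variable (F : T4Family) (N : ℕ) [NeZero N] (ν : Stage7Numerics) (M : ℕ)

/-- Bond-wise domination transports the (3.3) test: if every starred bond `b′` of run B's cube `c′` has a starred bond `b` of run A's cube `c` with
`|U′(b′)(V′-box)⁻¹ − 1| ≤ |U(b)(V-box)⁻¹ − 1| + Δ`, then «run A passes the (3.3) test at `δ′`» gives «run B passes it at `δ′ + Δ`». [folklore] -/
theorem smallApproxFluct_of_dominated {p p' : B12.RunParams} {g g' : ℕ → ℝ} {k k' : ℕ} (s : SeqOfRecord F ν M g p.K k) (s' : SeqOfRecord F ν M g' p'.K k')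
    (c : Iχ F ν p g k) (c' : Iχ F ν p' g' k') (U : GaugeField (F.P p.K) k (SU N)) (V : GaugeField (F.P p.K) (k + 1) (SU N))
    (U' : GaugeField (F.P p'.K) k' (SU N)) (V' : GaugeField (F.P p'.K) (k' + 1) (SU N)) {δ' Δ : ℝ}
    (h : ∀ b' ∈ (sect3DataOfRecord F N ν M p' g' k' s').bondsStar c', ∃ b ∈ (sect3DataOfRecord F N ν M p g k s).bondsStar c,
      dist1 (U' b' * (Vbox (sect3DataOfRecord F N ν M p' g' k' s') (avOfRecord F N p'.K) c' V' b')⁻¹) ≤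
        dist1 (U b * (Vbox (sect3DataOfRecord F N ν M p g k s) (avOfRecord F N p.K) c V b)⁻¹) + Δ)
    (hA : SmallApproxFluct (sect3DataOfRecord F N ν M p g k s) (avOfRecord F N p.K) δ' U V c) :
    SmallApproxFluct (sect3DataOfRecord F N ν M p' g' k' s') (avOfRecord F N p'.K) (δ' + Δ) U' V' c' := by
  intro b' hb'
  obtain ⟨b, hb, hle⟩ := h b' hb'
  have h1 := hA b hb
  linarith

/-- ★★ **THE DEVICE AT THE (3.3) FACTOR.**  Under the bond-wise domination of `smallApproxFluct_of_dominated` (the two-run closeness of the tested FLUCTUATION variables at the (3.3)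
scale — DISPLAYED): `bFactor^A_{δ′}(c)(U, V) ≤ bFactor^B_{δ′+Δ}(c′)(U′, V′)`. [bookkeeping] -/
theorem bFactorAt_le_bFactorAt_add_of_fluctDominated {p p' : B12.RunParams} {g g' : ℕ → ℝ} {k k' : ℕ} (s : SeqOfRecord F ν M g p.K k)
    (s' : SeqOfRecord F ν M g' p'.K k') (c : Iχ F ν p g k) (c' : Iχ F ν p' g' k') (U : GaugeField (F.P p.K) k (SU N)) (V : GaugeField (F.P p.K) (k + 1) (SU N))
    (U' : GaugeField (F.P p'.K) k' (SU N)) (V' : GaugeField (F.P p'.K) (k' + 1) (SU N)) {δ' Δ : ℝ}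
    (h : ∀ b' ∈ (sect3DataOfRecord F N ν M p' g' k' s').bondsStar c', ∃ b ∈ (sect3DataOfRecord F N ν M p g k s).bondsStar c,
      dist1 (U' b' * (Vbox (sect3DataOfRecord F N ν M p' g' k' s') (avOfRecord F N p'.K) c' V' b')⁻¹) ≤
        dist1 (U b * (Vbox (sect3DataOfRecord F N ν M p g k s) (avOfRecord F N p.K) c V b)⁻¹) + Δ) :
    bFactorAt F N ν M p g k δ' s c U V ≤ bFactorAt F N ν M p' g' k' (δ' + Δ) s' c' U' V' := by
  unfold bFactorAt
  by_cases hA : SmallApproxFluct (sect3DataOfRecord F N ν M p g k s) (avOfRecord F N p.K) δ' U V c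
  · rw [if_pos hA, if_pos (smallApproxFluct_of_dominated F N ν M s s' c c' U V U' V' h hA)]
  · rw [if_neg hA]; split_ifs <;> norm_num

/-- **FAMILY FORM, A → B** along a site identification `ι` (the binder `hdevAB` of §2 with run B's (3.3) factors through `ι`). [bookkeeping] -/
theorem bDevice_AB_of_fluctClose {p p' : B12.RunParams} {g g' : ℕ → ℝ} {k k' : ℕ} (ι : Iχ F ν p g k → Iχ F ν p' g' k') (s : SeqOfRecord F ν M g p.K k)
    (s' : SeqOfRecord F ν M g' p'.K k') (U : GaugeField (F.P p.K) k (SU N)) (V : GaugeField (F.P p.K) (k + 1) (SU N))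
    (U' : GaugeField (F.P p'.K) k' (SU N)) (V' : GaugeField (F.P p'.K) (k' + 1) (SU N)) {Δ : ℝ}
    (hAB : ∀ c : Iχ F ν p g k, ∀ b' ∈ (sect3DataOfRecord F N ν M p' g' k' s').bondsStar (ι c), ∃ b ∈ (sect3DataOfRecord F N ν M p g k s).bondsStar c,
      dist1 (U' b' * (Vbox (sect3DataOfRecord F N ν M p' g' k' s') (avOfRecord F N p'.K) (ι c) V' b')⁻¹) ≤
        dist1 (U b * (Vbox (sect3DataOfRecord F N ν M p g k s) (avOfRecord F N p.K) c V b)⁻¹) + Δ) :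
    ∀ (c : Iχ F ν p g k) (δ' : ℝ), bFactorAt F N ν M p g k δ' s c U V ≤ bFactorAt F N ν M p' g' k' (δ' + Δ) s' (ι c) U' V' :=
  fun c _ => bFactorAt_le_bFactorAt_add_of_fluctDominated F N ν M s s' c (ι c) U V U' V' (hAB c)

/-- **FAMILY FORM, B → A** (the binder `hdevBA`). [bookkeeping] -/
theorem bDevice_BA_of_fluctClose {p p' : B12.RunParams} {g g' : ℕ → ℝ} {k k' : ℕ} (ι : Iχ F ν p g k → Iχ F ν p' g' k') (s : SeqOfRecord F ν M g p.K k)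
    (s' : SeqOfRecord F ν M g' p'.K k') (U : GaugeField (F.P p.K) k (SU N)) (V : GaugeField (F.P p.K) (k + 1) (SU N))
    (U' : GaugeField (F.P p'.K) k' (SU N)) (V' : GaugeField (F.P p'.K) (k' + 1) (SU N)) {Δ : ℝ}
    (hBA : ∀ c : Iχ F ν p g k, ∀ b ∈ (sect3DataOfRecord F N ν M p g k s).bondsStar c, ∃ b' ∈ (sect3DataOfRecord F N ν M p' g' k' s').bondsStar (ι c),
      dist1 (U b * (Vbox (sect3DataOfRecord F N ν M p g k s) (avOfRecord F N p.K) c V b)⁻¹) ≤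
        dist1 (U' b' * (Vbox (sect3DataOfRecord F N ν M p' g' k' s') (avOfRecord F N p'.K) (ι c) V' b')⁻¹) + Δ) :
    ∀ (c : Iχ F ν p g k) (δ' : ℝ), bFactorAt F N ν M p' g' k' δ' s' (ι c) U' V' ≤ bFactorAt F N ν M p g k (δ' + Δ) s c U V :=
  fun c _ => bFactorAt_le_bFactorAt_add_of_fluctDominated F N ν M s' s (ι c) c U' V' U V (hBA c)

end Device

/-! ## §2 The junction at def-T's (3.3) weight `bWeightAt` and dag-n21-w7's gapped `bGapAt` -/

section Junction

variable (F : T4Family) (N : ℕ) [NeZero N] (ν : Stage7Numerics) (M : ℕ) (p : B12.RunParams) (g : ℕ → ℝ) (k : ℕ)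

/-- ★★ **THE GAPPED (3.3) WEIGHT LIES BELOW THE COMMON-REFINEMENT (3.3) CORE** for ANY run-B factor family `χB : Iχ → ℝ → ℝ` in `[0,1]`, monotone in the letter, with the two devices
against run A's `bFactorAt … s c U V′` and a collar `δlo + Δ ≤ δ′ ≤ δhi − Δ`, `0 ≤ Δ` (file 1 `prod_gapFamily_le_core_of_device`; dag-n21-w7 `bFactorAt_mul_self ∕ _nonneg ∕ _le_one ∕ _mono`
BY NAME). [bookkeeping] -/
theorem bGapAt_le_core_of_device {δlo δ' δhi Δ : ℝ} (s : SeqOfRecord F ν M g p.K k) {Pl Ql : Finset (Iχ F ν p g k)} (hQ : Ql ⊆ qcubes F ν M p g k s Pl)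
    (U : GaugeField (F.P p.K) k (SU N)) (V' : GaugeField (F.P p.K) (k + 1) (SU N)) (χB : Iχ F ν p g k → ℝ → ℝ)
    (h0B : ∀ c θ', 0 ≤ χB c θ') (h1B : ∀ c θ', χB c θ' ≤ 1) (hmB : ∀ c, Monotone (χB c))
    (hdevAB : ∀ c θ', bFactorAt F N ν M p g k θ' s c U V' ≤ χB c (θ' + Δ)) (hdevBA : ∀ c θ', χB c θ' ≤ bFactorAt F N ν M p g k (θ' + Δ) s c U V')
    (hΔ : 0 ≤ Δ) (hlo : δlo + Δ ≤ δ') (hhi : δ' + Δ ≤ δhi) :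
    bGapAt F N ν M p g k δlo δhi s Pl Ql U V' ≤
      (∏ c ∈ qcubes F ν M p g k s Pl \ Ql, (bFactorAt F N ν M p g k δ' s c U V' * χB c δ')) * ∏ c ∈ Ql, ((1 - bFactorAt F N ν M p g k δ' s c U V') * (1 - χB c δ')) := by
  rw [bGapAt_of_subset F N ν M p g k δlo δhi s hQ U V']
  exact prod_gapFamily_le_core_of_device (qcubes F ν M p g k s Pl) Ql (fun c θ' => bFactorAt F N ν M p g k θ' s c U V') χB
    (fun c θ' => bFactorAt_mul_self F N ν M p g k θ' s c U V') (fun c θ' => bFactorAt_nonneg F N ν M p g k θ' s c U V')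
    (fun c θ' => bFactorAt_le_one F N ν M p g k θ' s c U V') h0B h1B (fun c _ _ h => bFactorAt_mono F N ν M p g k h s c U V') hmB hdevAB hdevBA hΔ hlo hhi

/-- The common-refinement (3.3) core lies below def-T's `b|_{δ′}(P, Q)` itself. [bookkeeping] -/
theorem core_le_bWeightAt (δ' : ℝ) (s : SeqOfRecord F ν M g p.K k) {Pl Ql : Finset (Iχ F ν p g k)} (hQ : Ql ⊆ qcubes F ν M p g k s Pl)
    (U : GaugeField (F.P p.K) k (SU N)) (V' : GaugeField (F.P p.K) (k + 1) (SU N)) (χB : Iχ F ν p g k → ℝ → ℝ)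
    (h0B : ∀ c θ', 0 ≤ χB c θ') (h1B : ∀ c θ', χB c θ' ≤ 1) :
    (∏ c ∈ qcubes F ν M p g k s Pl \ Ql, (bFactorAt F N ν M p g k δ' s c U V' * χB c δ')) * ∏ c ∈ Ql, ((1 - bFactorAt F N ν M p g k δ' s c U V') * (1 - χB c δ')) ≤
      bWeightAt F N ν M p g k δ' s Pl Ql U V' := by
  rw [bWeightAt_eq_prod F N ν M p g k δ' s hQ U V']
  exact coreFamily_le_term (qcubes F ν M p g k s Pl) Ql (fun c θ' => bFactorAt F N ν M p g k θ' s c U V') χB δ'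
    (fun c θ' => bFactorAt_nonneg F N ν M p g k θ' s c U V') (fun c θ' => bFactorAt_le_one F N ν M p g k θ' s c U V') h0B h1B

/-- ★★★ **THE (3.3) JUNCTION, ANY RUN-B FAMILY**: design (i)'s deficit `b|_{δ′}(P,Q) − core` is at most dag-n21-w7's gapped deficit `b|_{δ′}(P,Q) − bGapAt δlo δhi s P Q`. [bookkeeping] -/
theorem bWeightAt_sub_core_le_bWeightAt_sub_bGapAt_of_device {δlo δ' δhi Δ : ℝ} (s : SeqOfRecord F ν M g p.K k) {Pl Ql : Finset (Iχ F ν p g k)}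
    (hQ : Ql ⊆ qcubes F ν M p g k s Pl) (U : GaugeField (F.P p.K) k (SU N)) (V' : GaugeField (F.P p.K) (k + 1) (SU N)) (χB : Iχ F ν p g k → ℝ → ℝ)
    (h0B : ∀ c θ', 0 ≤ χB c θ') (h1B : ∀ c θ', χB c θ' ≤ 1) (hmB : ∀ c, Monotone (χB c))
    (hdevAB : ∀ c θ', bFactorAt F N ν M p g k θ' s c U V' ≤ χB c (θ' + Δ)) (hdevBA : ∀ c θ', χB c θ' ≤ bFactorAt F N ν M p g k (θ' + Δ) s c U V')
    (hΔ : 0 ≤ Δ) (hlo : δlo + Δ ≤ δ') (hhi : δ' + Δ ≤ δhi) :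
    bWeightAt F N ν M p g k δ' s Pl Ql U V' -
        (∏ c ∈ qcubes F ν M p g k s Pl \ Ql, (bFactorAt F N ν M p g k δ' s c U V' * χB c δ')) * ∏ c ∈ Ql, ((1 - bFactorAt F N ν M p g k δ' s c U V') * (1 - χB c δ')) ≤
      bWeightAt F N ν M p g k δ' s Pl Ql U V' - bGapAt F N ν M p g k δlo δhi s Pl Ql U V' := by
  have h := bGapAt_le_core_of_device F N ν M p g k s hQ U V' χB h0B h1B hmB hdevAB hdevBA hΔ hlo hhi
  linarith

variable {p g k}

/-- ★★★ **THE (3.3) JUNCTION FROM TWO-RUN FLUCTUATION CLOSENESS**: run B's (3.3) factors `bFactor^B_{δ′}(ι c)(U′, V′)` read through `ι`, the two-way bond-wise domination (§1) and a collar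
clearing `Δ`: design (i)'s (3.3) deficit of `b|_{δ′}(P, Q)(U, V)` against run B is at most `b|_{δ′}(P, Q)(U, V) − bGapAt δlo δhi s P Q U V`. [bookkeeping] -/
theorem bWeightAt_sub_core_le_bWeightAt_sub_bGapAt_of_fluctClose {p' : B12.RunParams} {g' : ℕ → ℝ} {k' : ℕ} (ι : Iχ F ν p g k → Iχ F ν p' g' k')
    (s : SeqOfRecord F ν M g p.K k) (s' : SeqOfRecord F ν M g' p'.K k') (U : GaugeField (F.P p.K) k (SU N)) (V : GaugeField (F.P p.K) (k + 1) (SU N))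
    (U' : GaugeField (F.P p'.K) k' (SU N)) (V' : GaugeField (F.P p'.K) (k' + 1) (SU N)) {Δ : ℝ} (hΔ : 0 ≤ Δ)
    (hAB : ∀ c : Iχ F ν p g k, ∀ b' ∈ (sect3DataOfRecord F N ν M p' g' k' s').bondsStar (ι c), ∃ b ∈ (sect3DataOfRecord F N ν M p g k s).bondsStar c,
      dist1 (U' b' * (Vbox (sect3DataOfRecord F N ν M p' g' k' s') (avOfRecord F N p'.K) (ι c) V' b')⁻¹) ≤
        dist1 (U b * (Vbox (sect3DataOfRecord F N ν M p g k s) (avOfRecord F N p.K) c V b)⁻¹) + Δ)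
    (hBA : ∀ c : Iχ F ν p g k, ∀ b ∈ (sect3DataOfRecord F N ν M p g k s).bondsStar c, ∃ b' ∈ (sect3DataOfRecord F N ν M p' g' k' s').bondsStar (ι c),
      dist1 (U b * (Vbox (sect3DataOfRecord F N ν M p g k s) (avOfRecord F N p.K) c V b)⁻¹) ≤
        dist1 (U' b' * (Vbox (sect3DataOfRecord F N ν M p' g' k' s') (avOfRecord F N p'.K) (ι c) V' b')⁻¹) + Δ)
    {δlo δ' δhi : ℝ} (hlo : δlo + Δ ≤ δ') (hhi : δ' + Δ ≤ δhi) {Pl Ql : Finset (Iχ F ν p g k)} (hQ : Ql ⊆ qcubes F ν M p g k s Pl) :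
    bWeightAt F N ν M p g k δ' s Pl Ql U V -
        (∏ c ∈ qcubes F ν M p g k s Pl \ Ql, (bFactorAt F N ν M p g k δ' s c U V * bFactorAt F N ν M p' g' k' δ' s' (ι c) U' V')) *
          ∏ c ∈ Ql, ((1 - bFactorAt F N ν M p g k δ' s c U V) * (1 - bFactorAt F N ν M p' g' k' δ' s' (ι c) U' V')) ≤
      bWeightAt F N ν M p g k δ' s Pl Ql U V - bGapAt F N ν M p g k δlo δhi s Pl Ql U V :=
  bWeightAt_sub_core_le_bWeightAt_sub_bGapAt_of_device F N ν M p g k s hQ U V (fun c θ' => bFactorAt F N ν M p' g' k' θ' s' (ι c) U' V')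
    (fun c θ' => bFactorAt_nonneg F N ν M p' g' k' θ' s' (ι c) U' V') (fun c θ' => bFactorAt_le_one F N ν M p' g' k' θ' s' (ι c) U' V')
    (fun c _ _ h => bFactorAt_mono F N ν M p' g' k' h s' (ι c) U' V') (bDevice_AB_of_fluctClose F N ν M ι s s' U V U' V' hAB)
    (bDevice_BA_of_fluctClose F N ν M ι s s' U V U' V' hBA) hΔ hlo hhi

end Junction

/-! ## §3 On the support of run A's GAPPED (3.3) weight the two runs' (3.3) factors AGREE -/

section Support

variable (F : T4Family) (N : ℕ) [NeZero N] (ν : Stage7Numerics) (M : ℕ) {p : B12.RunParams} {g : ℕ → ℝ} {k : ℕ}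

/-- ★★ **IDENTICAL (3.3) INDICATOR SETS ON THE GAPPED SUPPORT.**  Under the hypotheses of `bGapAt_le_core_of_device` and `bGapAt δlo δhi s P Q U V′ ≠ 0`: run B's (3.3) factors at `δ′`
(the family `χB`, e.g. `bFactor^B(ι c)`) EQUAL run A's — `= 1` off `Q`, `= 0` on `Q`. [bookkeeping] -/
theorem bFactors_agree_on_gapped_support {δlo δ' δhi Δ : ℝ} (s : SeqOfRecord F ν M g p.K k) {Pl Ql : Finset (Iχ F ν p g k)} (hQ : Ql ⊆ qcubes F ν M p g k s Pl)
    (U : GaugeField (F.P p.K) k (SU N)) (V' : GaugeField (F.P p.K) (k + 1) (SU N)) (χB : Iχ F ν p g k → ℝ → ℝ)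
    (h0B : ∀ c θ', 0 ≤ χB c θ') (h1B : ∀ c θ', χB c θ' ≤ 1) (hmB : ∀ c, Monotone (χB c))
    (hdevAB : ∀ c θ', bFactorAt F N ν M p g k θ' s c U V' ≤ χB c (θ' + Δ)) (hdevBA : ∀ c θ', χB c θ' ≤ bFactorAt F N ν M p g k (θ' + Δ) s c U V')
    (hΔ : 0 ≤ Δ) (hlo : δlo + Δ ≤ δ') (hhi : δ' + Δ ≤ δhi) (hsupp : bGapAt F N ν M p g k δlo δhi s Pl Ql U V' ≠ 0) :
    (∀ c ∈ qcubes F ν M p g k s Pl \ Ql, bFactorAt F N ν M p g k δ' s c U V' = 1 ∧ χB c δ' = 1) ∧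
      (∀ c ∈ Ql, bFactorAt F N ν M p g k δ' s c U V' = 0 ∧ χB c δ' = 0) := by
  have hprod := bGapAt_of_subset F N ν M p g k δlo δhi s hQ U V'
  have hfac1 : ∀ c ∈ qcubes F ν M p g k s Pl \ Ql, bFactorAt F N ν M p g k δlo s c U V' = 1 := by
    intro c hc
    rcases eq_zero_or_one_of_mul_self (bFactorAt_mul_self F N ν M p g k δlo s c U V') with h | h
    · exact absurd (by rw [hprod, Finset.prod_eq_zero hc h, zero_mul]) hsupp
    · exact h
  have hfac2 : ∀ c ∈ Ql, bFactorAt F N ν M p g k δhi s c U V' = 0 := by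
    intro c hc
    rcases eq_zero_or_one_of_mul_self (bFactorAt_mul_self F N ν M p g k δhi s c U V') with h | h
    · exact h
    · exact absurd (by rw [hprod, Finset.prod_eq_zero hc (by rw [h, sub_self]), mul_zero]) hsupp
  have hgap1 : bGapAt F N ν M p g k δlo δhi s Pl Ql U V' = 1 := by
    rw [hprod, Finset.prod_eq_one fun c hc => hfac1 c hc, Finset.prod_eq_one fun c hc => by rw [hfac2 c hc, sub_zero], one_mul]
  have hcore := bGapAt_le_core_of_device F N ν M p g k s hQ U V' χB h0B h1B hmB hdevAB hdevBA hΔ hlo hhi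
  rw [hgap1] at hcore
  have hA0 := fun c => bFactorAt_nonneg F N ν M p g k δ' s c U V'
  have hA1 := fun c => bFactorAt_le_one F N ν M p g k δ' s c U V'
  have hX0 : 0 ≤ ∏ c ∈ qcubes F ν M p g k s Pl \ Ql, (bFactorAt F N ν M p g k δ' s c U V' * χB c δ') :=
    Finset.prod_nonneg fun c _ => mul_nonneg (hA0 c) (h0B c _)
  have hX1 : ∏ c ∈ qcubes F ν M p g k s Pl \ Ql, (bFactorAt F N ν M p g k δ' s c U V' * χB c δ') ≤ 1 :=
    Finset.prod_le_one (fun c _ => mul_nonneg (hA0 c) (h0B c _)) fun c _ => mul_le_one₀ (hA1 c) (h0B c _) (h1B c _)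
  have hY0 : 0 ≤ ∏ c ∈ Ql, ((1 - bFactorAt F N ν M p g k δ' s c U V') * (1 - χB c δ')) :=
    Finset.prod_nonneg fun c _ => mul_nonneg (sub_nonneg.2 (hA1 c)) (sub_nonneg.2 (h1B c _))
  have hY1 : ∏ c ∈ Ql, ((1 - bFactorAt F N ν M p g k δ' s c U V') * (1 - χB c δ')) ≤ 1 :=
    Finset.prod_le_one (fun c _ => mul_nonneg (sub_nonneg.2 (hA1 c)) (sub_nonneg.2 (h1B c _))) fun c _ =>
      mul_le_one₀ (sub_le_self _ (hA0 c)) (sub_nonneg.2 (h1B c _)) (sub_le_self _ (h0B c _))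
  have hX : 1 ≤ ∏ c ∈ qcubes F ν M p g k s Pl \ Ql, (bFactorAt F N ν M p g k δ' s c U V' * χB c δ') := by nlinarith
  have hY : 1 ≤ ∏ c ∈ Ql, ((1 - bFactorAt F N ν M p g k δ' s c U V') * (1 - χB c δ')) := by nlinarith
  have hXc := eq_one_of_prod_ge_one _ (fun c _ => mul_nonneg (hA0 c) (h0B c _)) (fun c _ => mul_le_one₀ (hA1 c) (h0B c _) (h1B c _)) hX
  have hYc := eq_one_of_prod_ge_one _ (fun c _ => mul_nonneg (sub_nonneg.2 (hA1 c)) (sub_nonneg.2 (h1B c _)))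
    (fun c _ => mul_le_one₀ (sub_le_self _ (hA0 c)) (sub_nonneg.2 (h1B c _)) (sub_le_self _ (h0B c _))) hY
  refine ⟨fun c hc => ?_, fun c hc => ?_⟩
  · have h := hXc c hc
    have := hA0 c; have := hA1 c; have := h0B c δ'; have := h1B c δ'
    constructor <;> nlinarith
  · have h := hYc c hc
    have := hA0 c; have := hA1 c; have := h0B c δ'; have := h1B c δ'
    constructor <;> nlinarith

end Support

/-! ## §4 The (3.3) grid `δ′_j = 2δ_k(1 − ρ′)^j`: collar steps against a closeness, and the factor-two window -/

section BGrid

variable (ν : Stage7Numerics) (A₁ : ℝ) (g : ℕ → ℝ) (k : ℕ)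

/-- One (3.3) grid step is `δ′_j − δ′_{j+1} = (2δ_k)(1 − ρ′)^j ρ′`. [bookkeeping] -/
theorem bCutGrid_sub_bCutGrid_succ (ρ' : ℝ) (j : ℕ) :
    bCutGrid ν A₁ g k ρ' j - bCutGrid ν A₁ g k ρ' (j + 1) = 2 * deltaOfRecord ν g k A₁ * ((1 - ρ') ^ j * ρ') := by
  rw [bCutGrid_succ]; unfold bCutGrid; ring

/-- ★ **A (3.3) GRID STEP CLEARS A CLOSENESS `(2δ_k)·δ′′`** as soon as `δ′′ ≤ (1 − ρ′)^j ρ′` (`0 ≤ δ_k`). [bookkeeping] -/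
theorem bCutGrid_succ_add_le (hδ : 0 ≤ deltaOfRecord ν g k A₁) {ρ' δ'' : ℝ} {j : ℕ} (h : δ'' ≤ (1 - ρ') ^ j * ρ') :
    bCutGrid ν A₁ g k ρ' (j + 1) + 2 * deltaOfRecord ν g k A₁ * δ'' ≤ bCutGrid ν A₁ g k ρ' j := by
  have h1 := bCutGrid_sub_bCutGrid_succ ν A₁ g k ρ' j
  have h2 : 2 * deltaOfRecord ν g k A₁ * δ'' ≤ 2 * deltaOfRecord ν g k A₁ * ((1 - ρ') ^ j * ρ') := mul_le_mul_of_nonneg_left h (by linarith)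
  linarith

/-- ★ **THE SELECTED (3.3) COLLAR CLEARS THE CLOSENESS ON BOTH SIDES** from the single row `δ′′ ≤ (1 − ρ′)^{j+1} ρ′` (`0 ≤ δ_k`, `0 ≤ ρ′ ≤ 1`). [bookkeeping] -/
theorem bCutGrid_collar_clears (hδ : 0 ≤ deltaOfRecord ν g k A₁) {ρ' δ'' : ℝ} (hρ0 : 0 ≤ ρ') (hρ1 : ρ' ≤ 1) {j : ℕ} (h : δ'' ≤ (1 - ρ') ^ (j + 1) * ρ') :
    bCutGrid ν A₁ g k ρ' (j + 2) + 2 * deltaOfRecord ν g k A₁ * δ'' ≤ bCutGrid ν A₁ g k ρ' (j + 1) ∧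
      bCutGrid ν A₁ g k ρ' (j + 1) + 2 * deltaOfRecord ν g k A₁ * δ'' ≤ bCutGrid ν A₁ g k ρ' j :=
  ⟨bCutGrid_succ_add_le ν A₁ g k hδ h,
    bCutGrid_succ_add_le ν A₁ g k hδ (h.trans (mul_le_mul_of_nonneg_right (pow_le_pow_of_le_one (by linarith) (by linarith) (Nat.le_succ j)) hρ0))⟩

/-- ★ **THE FACTOR-TWO WINDOW for the (3.3) letters**: `(1 − ρ′)^{n+2} ≥ 1/2`, `j ≤ n+2` ⇒ `δ_k ≤ δ′_j` (i.e. `(2δ_k)/2 ≤ δ′_j`), for `0 ≤ δ_k`, `0 ≤ ρ′ ≤ 1`. [bookkeeping] -/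
theorem half_letter_le_bCutGrid (hδ : 0 ≤ deltaOfRecord ν g k A₁) {ρ' : ℝ} (hρ0 : 0 ≤ ρ') (hρ1 : ρ' ≤ 1) {n j : ℕ} (hhalf : (1 : ℝ) / 2 ≤ (1 - ρ') ^ (n + 2))
    (hj : j ≤ n + 2) : deltaOfRecord ν g k A₁ ≤ bCutGrid ν A₁ g k ρ' j := by
  have h1 : (1 : ℝ) / 2 ≤ (1 - ρ') ^ j := hhalf.trans (pow_le_pow_of_le_one (by linarith) (by linarith) hj)
  unfold bCutGrid
  nlinarith

/-- … and at most `2δ_k`. [bookkeeping] -/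
theorem bCutGrid_le_letter (hδ : 0 ≤ deltaOfRecord ν g k A₁) {ρ' : ℝ} (hρ0 : 0 ≤ ρ') (hρ1 : ρ' ≤ 1) (j : ℕ) :
    bCutGrid ν A₁ g k ρ' j ≤ 2 * deltaOfRecord ν g k A₁ :=
  mul_le_of_le_one_right (by linarith) (pow_le_one₀ (by linarith) (by linarith))

/-- ★ **(3.3) DIALS ⇒ COLLAR ROWS AT `bCutGrid`.**  For dials `(ρ′, n₂)` as produced by file 2's `exists_dials_of_summable` read with the (3.3) RELATIVE closeness letter `δ′′` (units of
`2δ_k`) and `0 ≤ δ_k`: at every depth `j ≤ n₂` the collar `(δ′_{j+2}, δ′_{j+1}, δ′_j)` clears `(2δ_k)·δ′′` on both sides and lies in `[δ_k, 2δ_k]`. [bookkeeping] -/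
theorem bCollar_rows_of_dials (hδ : 0 ≤ deltaOfRecord ν g k A₁) {ρ' δ'' : ℝ} {n : ℕ} (hρ0 : 0 ≤ ρ') (hρ1 : ρ' ≤ 1)
    (hhalf : (1 : ℝ) / 2 ≤ (1 - ρ') ^ (n + 2)) (hcompat : ∀ i, i ≤ n + 2 → δ'' ≤ (1 - ρ') ^ i * ρ') {j : ℕ} (hj : j ≤ n) :
    bCutGrid ν A₁ g k ρ' (j + 2) + 2 * deltaOfRecord ν g k A₁ * δ'' ≤ bCutGrid ν A₁ g k ρ' (j + 1) ∧
      bCutGrid ν A₁ g k ρ' (j + 1) + 2 * deltaOfRecord ν g k A₁ * δ'' ≤ bCutGrid ν A₁ g k ρ' j ∧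
      deltaOfRecord ν g k A₁ ≤ bCutGrid ν A₁ g k ρ' (j + 2) ∧ bCutGrid ν A₁ g k ρ' j ≤ 2 * deltaOfRecord ν g k A₁ := by
  have hc := bCutGrid_collar_clears ν A₁ g k hδ hρ0 hρ1 (hcompat (j + 1) (by omega))
  exact ⟨hc.1, hc.2, half_letter_le_bCutGrid ν A₁ g k hδ hρ0 hρ1 hhalf (by omega), bCutGrid_le_letter ν A₁ g k hδ hρ0 hρ1 j⟩

end BGrid

/-! ## §5 A2 ∕ A6 sanity: one run against itself inhabits the fluctuation-domination hypothesis, and the (3.3) junction then recovers dag-n21-w7's `bGapAt ≤ bWeightAt` -/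

section Self

variable (F : T4Family) (N : ℕ) [NeZero N] (ν : Stage7Numerics) (M : ℕ) {p : B12.RunParams} {g : ℕ → ℝ} {k : ℕ}

/-- **A2: THE BOND-WISE DOMINATION IS INHABITED** — a run's fluctuation variables dominate themselves with `Δ′ = 0` (witness `b := b′`). [bookkeeping] -/
theorem fluctDominated_refl (s : SeqOfRecord F ν M g p.K k) (c : Iχ F ν p g k) (U : GaugeField (F.P p.K) k (SU N)) (V : GaugeField (F.P p.K) (k + 1) (SU N)) :
    ∀ b' ∈ (sect3DataOfRecord F N ν M p g k s).bondsStar c, ∃ b ∈ (sect3DataOfRecord F N ν M p g k s).bondsStar c,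
      dist1 (U b' * (Vbox (sect3DataOfRecord F N ν M p g k s) (avOfRecord F N p.K) c V b')⁻¹) ≤
        dist1 (U b * (Vbox (sect3DataOfRecord F N ν M p g k s) (avOfRecord F N p.K) c V b)⁻¹) + 0 :=
  fun b' hb' => ⟨b', hb', by simp⟩

/-- ★ **A6: THE (3.3) JUNCTION AT ONE RUN AGAINST ITSELF RECOVERS dag-n21-w7's `bGapAt ≤ bWeightAt`** (`ι = id`, `Δ′ = 0`; the (3.3) core of `b|_{δ′}(P,Q)` with itself IS
`b|_{δ′}(P,Q)` by `bFactorAt_mul_self`): for `δlo ≤ δ′ ≤ δhi` on the (3.3) range, `bGapAt δlo δhi s P Q U V ≤ bWeightAt δ′ s P Q U V`. [bookkeeping] -/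
theorem bGapAt_le_bWeightAt_of_self {δlo δ' δhi : ℝ} (hlo : δlo ≤ δ') (hhi : δ' ≤ δhi) (s : SeqOfRecord F ν M g p.K k) {Pl Ql : Finset (Iχ F ν p g k)}
    (hQ : Ql ⊆ qcubes F ν M p g k s Pl) (U : GaugeField (F.P p.K) k (SU N)) (V : GaugeField (F.P p.K) (k + 1) (SU N)) :
    bGapAt F N ν M p g k δlo δhi s Pl Ql U V ≤ bWeightAt F N ν M p g k δ' s Pl Ql U V := by
  have h := bGapAt_le_core_of_device F N ν M p g k s hQ U V (fun c θ' => bFactorAt F N ν M p g k θ' s c U V)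
    (fun c θ' => bFactorAt_nonneg F N ν M p g k θ' s c U V) (fun c θ' => bFactorAt_le_one F N ν M p g k θ' s c U V)
    (fun c _ _ h => bFactorAt_mono F N ν M p g k h s c U V)
    (bDevice_AB_of_fluctClose F N ν M (id : Iχ F ν p g k → Iχ F ν p g k) s s U V U V fun c => fluctDominated_refl F N ν M s c U V)
    (bDevice_BA_of_fluctClose F N ν M (id : Iχ F ν p g k → Iχ F ν p g k) s s U V U V fun c => fluctDominated_refl F N ν M s c U V)
    le_rfl (by simpa using hlo) (by simpa using hhi)
  have hcore : (∏ c ∈ qcubes F ν M p g k s Pl \ Ql, (bFactorAt F N ν M p g k δ' s c U V * bFactorAt F N ν M p g k δ' s c U V)) *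
      ∏ c ∈ Ql, ((1 - bFactorAt F N ν M p g k δ' s c U V) * (1 - bFactorAt F N ν M p g k δ' s c U V)) = bWeightAt F N ν M p g k δ' s Pl Ql U V := by
    rw [bWeightAt_eq_prod F N ν M p g k δ' s hQ U V]
    congr 1
    · exact prod_congr rfl fun c _ => bFactorAt_mul_self F N ν M p g k δ' s c U V
    · refine prod_congr rfl fun c _ => ?_
      have e := bFactorAt_mul_self F N ν M p g k δ' s c U V
      nlinarith [e]
  simpa only [id] using hcore ▸ h

end Self

end Summit.QuantumFields.YangMills.Theorems.N21GappedCollarDesignIPair
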